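import Literature.NumberTheory.EllipticCurves.PadicSigmaThreeExistence
import HarnessLib

/-!
# The canonical `2`-torsion abscissa over ANY `2`-adically complete ring (universal form of step S2 of the discharge
# plan for the PRINT stub `stub_sigmaSqTwo` of crux C3′; route-independent)

Cell `bsd-f1-sign2`, WIDTH-5 attach seat `bsd-line-att-p3` g8 (`--supports stmt-BirchSwinnertonDyer-23008`; plan
`Cruxes/BSDOfMainConjectureRankOneAtTwo/SIGMASQ-AT-TWO-att-p3.md`, step S2). THEOREMS ONLY. BSD is not proved by any of this.
The `ℤ₂`-version is `…SigmaSqTwoCanonicalPoint.lean` (Mathlib's `hensels_lemma` for `ℤ_p`); here the same statement over an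
arbitrary commutative ring `A` complete for the `(2)`-adic topology (e.g. the universal `a₁`-chart ring `R̂₂` of plan S1), by the
tree's one-variable Newton lemma in adically complete rings (`PadicSigmaThree.Universal.exists_root_of_newton`).

* `exists_canonical_twoTorsionX_adic` — for `W/A` with `a₁ ∈ Aˣ`: a UNIT `X₀` with `X₀³ + b₂X₀² + 8b₄X₀ + 16b₆ = 0` and
  `X₀ + b₂ ∈ (2)` (so `x(Q) = X₀/4`, `Q` the generator of the canonical subgroup `μ₂ ⊂ E[2]`);
* `canonical_twoTorsionX_adic_unique` — uniqueness among elements `≡ −b₂ (mod 2)` (any such ring, no domain hypothesis).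

## Sources
* N. M. Katz, LNM 350 (1973), §3 (canonical subgroup of an ordinary curve = kernel of Frobenius). [cite: MazurTate1991, Thm. 3.1]
* J. H. Silverman, *AEC* 2nd ed., III.1 (`ψ₂² = 4x³ + b₂x² + 2b₄x + b₆`), VII.3. [cite: SilvermanAEC2009, VII.3 Prop. 3.1]
* D. Eisenbud, *Commutative Algebra*, Thm. 7.3 (Hensel's lemma). [cite: Eisenbud1995, Thm. 7.3]
-/

noncomputable section

set_option linter.dupNamespace false
set_option autoImplicit false

open Polynomial

namespace Summit.BirchSwinnertonDyer.BirchSwinnertonDyer.Theorems.AlignedTransportAtTwoSigmaSqTwo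

variable {A : Type*} [CommRing A] [IsAdicComplete (Ideal.span {(2 : A)}) A] (W : WeierstrassCurve A)

omit [IsAdicComplete (Ideal.span {(2 : A)}) A] in
/-- `b₂ = a₁² + 2·(2a₂)`: modulo `(2)`, `b₂ ≡ a₁²`. [cite: SilvermanAEC2009, III.1] -/
theorem b₂_sub_a₁_sq_mem : W.b₂ - W.a₁ ^ 2 ∈ Ideal.span {(2 : A)} :=
  Ideal.mem_span_singleton.mpr ⟨2 * W.a₂, by rw [WeierstrassCurve.b₂]; ring⟩

/-- An element congruent to a unit modulo `(2)` is a unit (`(2) ⊆` Jacobson radical of a `2`-adically complete ring). [folklore] -/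
theorem isUnit_of_sub_mem {x y : A} (hy : IsUnit y) (h : x - y ∈ Ideal.span {(2 : A)}) : IsUnit x := by
  refine Literature.RingTheory.AdicTopology.isUnit_of_isUnit_mk (Ideal.span {(2 : A)}) ?_
  have e : Ideal.Quotient.mk (Ideal.span {(2 : A)}) x = Ideal.Quotient.mk (Ideal.span {(2 : A)}) y := by
    rw [Ideal.Quotient.eq]; exact h
  rw [e]; exact hy.map _

/-- **The canonical `2`-torsion abscissa over a `2`-adically complete ring.** For `W/A` with `a₁ ∈ Aˣ` there is a unit `X₀ ∈ A`
with `X₀³ + b₂X₀² + 8b₄X₀ + 16b₆ = 0` and `X₀ ≡ −b₂ (mod 2)` (Newton from `X = −b₂`: `Q(−b₂) = 8(2b₆ − b₂b₄) ∈ (2)`,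
`Q'(−b₂) = b₂² + 8b₄ ≡ a₁⁴` a unit). [cite: SilvermanAEC2009, VII.3 Prop. 3.1] [cite: Eisenbud1995, Thm. 7.3] -/
theorem exists_canonical_twoTorsionX_adic (ha : IsUnit W.a₁) :
    ∃ X₀ : A, IsUnit X₀ ∧ X₀ ^ 3 + W.b₂ * X₀ ^ 2 + 8 * W.b₄ * X₀ + 16 * W.b₆ = 0 ∧ X₀ + W.b₂ ∈ Ideal.span {(2 : A)} := by
  set I : Ideal A := Ideal.span {(2 : A)} with hI
  set Q : A[X] := X ^ 3 + C W.b₂ * X ^ 2 + C (8 * W.b₄) * X + C (16 * W.b₆) with hQ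
  have hQeval : ∀ z : A, Q.eval z = z ^ 3 + W.b₂ * z ^ 2 + 8 * W.b₄ * z + 16 * W.b₆ := by
    intro z; simp [hQ]
  have hQder : ∀ z : A, Q.derivative.eval z = 3 * z ^ 2 + 2 * W.b₂ * z + 8 * W.b₄ := by
    intro z; simp [hQ]; ring
  have h0 : Q.eval (-W.b₂) ∈ I :=
    Ideal.mem_span_singleton.mpr ⟨4 * (2 * W.b₆ - W.b₂ * W.b₄), by rw [hQeval]; ring⟩
  have hb₂u : IsUnit W.b₂ := isUnit_of_sub_mem (ha.pow 2) (b₂_sub_a₁_sq_mem W)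
  have hd : IsUnit (Q.derivative.eval (-W.b₂)) := by
    rw [hQder]
    refine isUnit_of_sub_mem (hb₂u.pow 2) (Ideal.mem_span_singleton.mpr ⟨4 * W.b₄, by ring⟩)
  obtain ⟨X₀, hroot, hclose⟩ :=
    Literature.NumberTheory.EllipticCurves.PadicSigmaThree.Universal.exists_root_of_newton I Q (-W.b₂) h0 hd
  refine ⟨X₀, ?_, by rw [← hQeval]; exact hroot, by rw [show X₀ + W.b₂ = X₀ - -W.b₂ by ring]; exact hclose⟩
  exact isUnit_of_sub_mem hb₂u.neg hclose

/-- **Uniqueness of the canonical abscissa**: two roots of `X³ + b₂X² + 8b₄X + 16b₆` that are `≡ −b₂ (mod 2)` coincide (the cofactor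
`X₁² + X₁X₂ + X₂² + b₂(X₁ + X₂) + 8b₄ ≡ b₂²` is a unit). [cite: SilvermanAEC2009, VII.3 Prop. 3.1] -/
theorem canonical_twoTorsionX_adic_unique (ha : IsUnit W.a₁) {X₁ X₂ : A}
    (h₁ : X₁ ^ 3 + W.b₂ * X₁ ^ 2 + 8 * W.b₄ * X₁ + 16 * W.b₆ = 0) (hc₁ : X₁ + W.b₂ ∈ Ideal.span {(2 : A)})
    (h₂ : X₂ ^ 3 + W.b₂ * X₂ ^ 2 + 8 * W.b₄ * X₂ + 16 * W.b₆ = 0) (hc₂ : X₂ + W.b₂ ∈ Ideal.span {(2 : A)}) : X₁ = X₂ := by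
  set I : Ideal A := Ideal.span {(2 : A)} with hI
  have hb₂u : IsUnit W.b₂ := isUnit_of_sub_mem (ha.pow 2) (b₂_sub_a₁_sq_mem W)
  have hfac : (X₁ - X₂) * (X₁ ^ 2 + X₁ * X₂ + X₂ ^ 2 + W.b₂ * (X₁ + X₂) + 8 * W.b₄) = 0 := by
    linear_combination h₁ - h₂
  obtain ⟨d₁, hd₁⟩ := Ideal.mem_span_singleton.mp hc₁
  obtain ⟨d₂, hd₂⟩ := Ideal.mem_span_singleton.mp hc₂
  have hU : IsUnit (X₁ ^ 2 + X₁ * X₂ + X₂ ^ 2 + W.b₂ * (X₁ + X₂) + 8 * W.b₄) := by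
    refine isUnit_of_sub_mem (hb₂u.pow 2) (Ideal.mem_span_singleton.mpr ⟨d₁ * (2 * d₁ + 2 * d₂ - 2 * W.b₂) + d₂ * (2 * d₂ - 2 * W.b₂) + 4 * W.b₄, ?_⟩)
    have e1 : X₁ = 2 * d₁ - W.b₂ := by linear_combination hd₁
    have e2 : X₂ = 2 * d₂ - W.b₂ := by linear_combination hd₂
    rw [e1, e2]; ring
  have h := hfac
  rw [mul_comm] at h
  exact sub_eq_zero.mp (hU.mul_right_eq_zero.mp h)

end Summit.BirchSwinnertonDyer.BirchSwinnertonDyer.Theorems.AlignedTransportAtTwoSigmaSqTwo
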